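/-
COR-CM (cell pub-hodgecm2, stage 2 of the Hodge ladder) — count-neutral KERNEL COMBINATORICS «the sheared dihedral family», part XVII: the blocks of
`(G, c)` along a slice datum of square class `0` are the blocks of the `X_n` label model (seat prover-pub-hodgecm2-b23-g52-0, binder prover b23, gen 52;
claim «SYLOW TRANSFER XII + THE SHEARED DIHEDRAL FAMILY», HOME/INBOX.md l.23708).  PORT of gen 44ʼs `Census/QuarticInversionTransport.lean` §6 with
`twS`/`BlockS`: one bookkeeping definition with body (`blockEquivS`) + theorems, on parts VIII/XIII/XV BY NAME; no `decide`, no certificate, no named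
fact, no `sorry`.  `Interfaces.lean` (C1), every E term, B01, `Transposition/*`, `PortJoin/*`, `D2Bridge/*` untouched.
HONEST FRAMING: `HC_CM` is NOT proved, here or anywhere in the tree; nothing here is a period, a count of record or a headline.
-/
import Summits.HodgeConjecture.CorCM.Census.ShearedDihedralSlicePlaces
import Summits.HodgeConjecture.CorCM.Census.ShearedDihedralResidualBlocks

/-!
# The sheared dihedral family, XVII: `Block c ≃ BlockS A` along a slice datum of square class `0`; `β(G, c) = #BlockS A`

Along `D : SliceDatum G c A 0` (parts VII–VIII; for odd `n` every sheared dihedral datum gives one, part IX): a chain of model motions from `ty Ψ` is a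
base change (`exists_rt_of_reachS`), so **two abstract CM types lie in the same block iff their labels lie in the same model block**
(`exists_rt_iff_reachS`), **`blockEquivS : BlockParity.Block c ≃ BlockS A`** and **`card_block_eqS : β(G, c) = #BlockS A`**; with part XVI, at least
twelve residual blocks, and with part II `#BlockS A = φ₂(G, c) + 2`.  All [folklore].

## References
* [Pohlmann1968] H. Pohlmann, Algebraic cycles on abelian varieties of complex multiplication type, Ann. of Math. 88 (1968), Thm 1.
-/

namespace Summit.HodgeConjecture.CorCM.Census.ShearedDihedral

open Finset
open Summit.HodgeConjecture.CorCM.Prior.AllgGroup.RfwfAllgGroup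
open Summit.HodgeConjecture.CorCM.Census.BlockParity
open Summit.HodgeConjecture.CorCM.Census.OddSliceFacesModel
open Summit.HodgeConjecture.CorCM.Census.QuarticInversion

noncomputable section

variable {G : Type*} [Group G] [Fintype G] [DecidableEq G] {c : G}
variable {A : Type} [AddCommGroup A] [Fintype A] [DecidableEq A]
variable (D : SliceDatum G c A 0)

omit [Fintype A] [DecidableEq A] in
/-- A chain of model motions from `ty Ψ` is realised by a base change. [folklore] -/
theorem exists_rt_of_reachS (Ψ : CMF G c) {Θ' : Ty₄ A}
    (h : Relation.ReflTransGen
      (fun Θ₁ Θ₂ : Ty₄ A => (∃ g : ZMod 2 × A, Θ₂ = twH₄ A g Θ₁) ∨ Θ₂ = twY A 0 Θ₁ ∨ Θ₂ = twS A Θ₁) (ty D Ψ) Θ') :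
    ∃ Q : G, ty D (rt c Q Ψ) = Θ' := by
  induction h with
  | refl => exact ⟨1, by rw [rt_one]⟩
  | tail _ hs ih =>
    obtain ⟨Q, hQ⟩ := ih
    rcases hs with ⟨g, rfl⟩ | rfl | rfl
    · exact ⟨D.ι g * Q, by rw [rt_mul, (ty_rt_gens D).1, hQ]⟩
    · exact ⟨D.y * Q, by rw [rt_mul, (ty_rt_gens D).2.1, hQ]⟩
    · exact ⟨D.t * Q, by rw [rt_mul, ty_rt_t, hQ]⟩

omit [DecidableEq A] in
/-- **Same block in `(G, c)` ↔ same block in the `X_n` model.** [folklore] -/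
theorem exists_rt_iff_reachS (Ψ Ψ' : CMF G c) : (∃ Q : G, rt c Q Ψ = Ψ') ↔
    Relation.ReflTransGen (fun Θ₁ Θ₂ : Ty₄ A => (∃ g : ZMod 2 × A, Θ₂ = twH₄ A g Θ₁) ∨ Θ₂ = twY A 0 Θ₁ ∨ Θ₂ = twS A Θ₁)
      (ty D Ψ) (ty D Ψ') := by
  constructor
  · rintro ⟨Q, rfl⟩
    obtain ⟨k, a, rfl⟩ := exists_word D Q
    have hH : ∀ X : CMF G c, Relation.ReflTransGen
        (fun Θ₁ Θ₂ : Ty₄ A => (∃ g : ZMod 2 × A, Θ₂ = twH₄ A g Θ₁) ∨ Θ₂ = twY A 0 Θ₁ ∨ Θ₂ = twS A Θ₁) (ty D X) (ty D (rt c (D.ι a) X)) :=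
      fun X => Relation.ReflTransGen.single (Or.inl ⟨a, (ty_rt_gens D).1 a X⟩)
    have hY : ∀ X : CMF G c, Relation.ReflTransGen
        (fun Θ₁ Θ₂ : Ty₄ A => (∃ g : ZMod 2 × A, Θ₂ = twH₄ A g Θ₁) ∨ Θ₂ = twY A 0 Θ₁ ∨ Θ₂ = twS A Θ₁) (ty D X) (ty D (rt c D.y X)) :=
      fun X => Relation.ReflTransGen.single (Or.inr (Or.inl ((ty_rt_gens D).2.1 X)))
    have hT : ∀ X : CMF G c, Relation.ReflTransGen
        (fun Θ₁ Θ₂ : Ty₄ A => (∃ g : ZMod 2 × A, Θ₂ = twH₄ A g Θ₁) ∨ Θ₂ = twY A 0 Θ₁ ∨ Θ₂ = twS A Θ₁) (ty D X) (ty D (rt c D.t X)) :=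
      fun X => Relation.ReflTransGen.single (Or.inr (Or.inr (ty_rt_t D X)))
    fin_cases k
    · exact hH Ψ
    · show Relation.ReflTransGen _ (ty D Ψ) (ty D (rt c (D.y * D.ι a) Ψ))
      rw [rt_mul]; exact (hH Ψ).trans (hY _)
    · show Relation.ReflTransGen _ (ty D Ψ) (ty D (rt c (D.t * D.ι a) Ψ))
      rw [rt_mul]; exact (hH Ψ).trans (hT _)
    · show Relation.ReflTransGen _ (ty D Ψ) (ty D (rt c (D.t * (D.y * D.ι a)) Ψ))
      rw [rt_mul, rt_mul]; exact ((hH Ψ).trans (hY _)).trans (hT _)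
  · intro h
    obtain ⟨Q, hQ⟩ := exists_rt_of_reachS D Ψ h
    exact ⟨Q, ty_injective D hQ⟩

/-- **The blocks of `(G, c)` are the blocks of the `X_n` model**: `Block c ≃ BlockS A`. [folklore] -/
def blockEquivS : BlockParity.Block c ≃ BlockS A :=
  Quotient.congr (typeEquiv D) fun Ψ Ψ' => exists_rt_iff_reachS D Ψ Ψ'

include D in
/-- **`β(G, c) = #BlockS A`.** [folklore] -/
theorem card_block_eqS : Fintype.card (BlockParity.Block c) = Fintype.card (BlockS A) := Fintype.card_congr (blockEquivS D)

include D in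
/-- **At least twelve residual model blocks along a slice datum** (`|B|` odd `≥ 3`; part XVI, restated for the reader of this file). [folklore] -/
theorem twelve_le_card_residualS' (hA : Odd (Fintype.card A)) (h2 : 2 ≤ Fintype.card A) :
    12 ≤ (univ.filter fun B : BlockS A => potBS A B ≤ 1).card ∧ Fintype.card (BlockParity.Block c) = Fintype.card (BlockS A) :=
  ⟨twelve_le_card_residualS A hA h2, card_block_eqS D⟩

end

end Summit.HodgeConjecture.CorCM.Census.ShearedDihedral
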